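import Literature.NumberTheory.Automorphic.CuspidalPeterssonForm
import Literature.NumberTheory.Automorphic.CuspFormSliceReduction
import Literature.NumberTheory.Automorphic.AutomorphicRepsGLCuspidalUnitary
import HarnessLib

/-!
# The Petersson form of a clean cuspidal representation of `GL_n` is `K_∞`-invariant

Topic `NumberTheory/Automorphic`; theorems only (no definition, no named fact, no `sorry`).
Companion of `CuspidalPeterssonForm`: for a unitary twist `T = |det|_𝔸^s` of a clean cuspidal
`π = W / W'` (`W ≤ 𝒜₀`, `W' = ⊥`) and an automorphic measure `μ`, the Petersson form
`⟪x, y⟫ = ∫ \overline{(|det|^s x)↓} (|det|^s y)↓ dμ` (`UnitaryTwist.pet`) is invariant under the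
right translation action `kRepW` of `K_∞` on `W`:

* `UnitaryTwist.detTwist_ofK_eq_one` — `|det k|_𝔸^s = 1` for `k ∈ K_∞` (orthogonal / unitary
  matrices have determinants of modulus one at every infinite place,
  `detNormUnit_ofInfinite_eq_one_of_mem_Kinf`);
* `UnitaryTwist.form_eq_quotFun`, `UnitaryTwist.form_kRepW` — the twisted form read on the quotient is
  the descent `quotFun (|det|^s x)`, and `(|det|^s (r(k) x))↓ = (|det|^s x)↓ (k⁻¹ • ·)`
  (`rightTranslation_mulChar`, `quotFun_rightTranslation`);
* `UnitaryTwist.pet_kRepW` — **`⟪r(k) x, r(k) y⟫ = ⟪x, y⟫`** by the invariance of `μ`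
  (`MeasureTheory.integral_smul_eq_self`).

Borel 1997, 11.12 (2) (the Petersson product is `G(𝔸)`-invariant on cusp forms); Knapp–Vogan 1995,
Ch. IX §1. [cite: Borel1997, 11.12 (2)]

## References

* A. Borel, *Automorphic forms on `SL₂(ℝ)`* (1997), 11.12. [Borel1997]
* A. Borel, H. Jacquet, Corvallis 1979, 4.6, 5.7. [BorelJacquetCorvallis1979]
-/

noncomputable section

open scoped Matrix ComplexConjugate Classical NNReal
open Complex NumberField NumberField.mixedEmbedding NumberField.InfinitePlace IsDedekindDomain
open _root_.MeasureTheory _root_.MeasureTheory.Measure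

namespace Literature.NumberTheory.Automorphic

namespace AutomorphicRepData

namespace UnitaryTwist

open Literature.NumberTheory.GaloisRepresentations (HeckeCharacter ideleGroup)

variable {n : ℕ} {K : Type} [Field K] [NumberField K] {hcpt : isCompact_glFiniteIntegralLevel n K}
  {π : AutomorphicRepData (AutomorphyDatum.gl n K hcpt)} (T : UnitaryTwist π)

/-- **`|det k|_𝔸^s = 1` on `K_∞`.** [folklore] -/
theorem detTwist_ofK_eq_one (k : (AutomorphyDatum.gl n K hcpt).arch.maximalCompact) :
    ((detTwist n T.χ ((AutomorphyDatum.gl n K hcpt).ofK k) : ℂˣ) : ℂ) = 1 := by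
  have hk : (k : GL (Fin n) (mixedSpace K)) ∈ Kinf n K := k.2
  have h1 := congrArg (fun u : ℝ≥0ˣ => ((u : ℝ≥0) : ℝ)) (detNormUnit_ofInfinite_eq_one_of_mem_Kinf hk)
  simp only [coe_coe_detNormUnit, Units.val_one, NNReal.coe_one] at h1
  rw [detTwist_apply', T.hχ]
  change ((GaloisRepresentations.ideleNorm (Matrix.GeneralLinearGroup.det (GLn.ofInfinite n K (k : GL (Fin n) (mixedSpace K)))) : ℂ)) ^ T.s = 1
  rw [h1, Complex.ofReal_one, Complex.one_cpow]

/-- The twisted form read on the quotient is the descent `quotFun (|det|^s x)`. [folklore] -/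
theorem form_eq_quotFun (x : π.W) :
    T.form x = (AdelicGroupData.gl n K).quotFun (mulChar (detTwist n T.χ) (x : (AdelicGroupData.gl n K).Adelic → ℂ)) := by
  rw [AdelicGroupData.quotFun_eq_descend (T.inv x x.2)]
  rfl

/-- **`(|det|^s (r(k) x))↓ = (|det|^s x)↓ (k⁻¹ • ·)`** for `k ∈ K_∞`. [folklore] -/
theorem form_kRepW (k : (AutomorphyDatum.gl n K hcpt).arch.maximalCompact) (x : π.W) :
    T.form (π.kRepW k x) = fun q => T.form x (((AutomorphyDatum.gl n K hcpt).ofK k)⁻¹ • q) := by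
  rw [form_eq_quotFun, form_eq_quotFun, ← AdelicGroupData.quotFun_rightTranslation (T.inv x x.2)]
  congr 1
  have h := rightTranslation_mulChar (AdelicGroupData.gl n K) (detTwist n T.χ) ((AutomorphyDatum.gl n K hcpt).ofK k)
    (x : (AdelicGroupData.gl n K).Adelic → ℂ)
  rw [T.detTwist_ofK_eq_one k, one_smul] at h
  exact h.symm

variable (μ : Measure (AdelicGroupData.gl n K).automorphicQuotient) [(AdelicGroupData.gl n K).IsAutomorphicMeasure μ]

/-- **The Petersson form is `K_∞`-invariant**: `⟪r(k) x, r(k) y⟫ = ⟪x, y⟫` for `k ∈ K_∞`.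
[cite: Borel1997, 11.12 (2)] -/
theorem pet_kRepW (k : (AutomorphyDatum.gl n K hcpt).arch.maximalCompact) (x y : π.W) :
    T.pet μ (π.kRepW k x) (π.kRepW k y) = T.pet μ x y := by
  rw [pet, pet, T.form_kRepW k x, T.form_kRepW k y]
  exact integral_smul_eq_self (μ := μ) (fun q => conj (T.form x q) * T.form y q)

end UnitaryTwist

end AutomorphicRepData

end Literature.NumberTheory.Automorphic

end
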